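import Summits.AtomisticToContinuum.Crystallization.Theorems.GappedShellCensusCleanLimitsHaveWindowsCleanChartTSteps1
import Summits.AtomisticToContinuum.Crystallization.Theorems.GappedShellCensusCleanLimitsHaveWindowsCleanChartTSteps2
import Summits.AtomisticToContinuum.Crystallization.Theorems.GappedShellCensusCleanLimitsHaveWindowsCleanChartTSteps3
import Summits.AtomisticToContinuum.Crystallization.Theorems.GappedShellCensusCleanLimitsHaveWindowsCleanChartTSteps5
import Summits.AtomisticToContinuum.Crystallization.Theorems.GappedShellCensusCleanLimitsHaveWindowsCleanChartTVinv
import Summits.AtomisticToContinuum.Crystallization.Theorems.GappedShellCensusCleanLimitsHaveWindowsCleanChartTAttach1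
import Summits.AtomisticToContinuum.Crystallization.Theorems.GappedShellCensusCleanLimitsHaveWindowsCleanChartTAttach2
import Summits.AtomisticToContinuum.Crystallization.Theorems.GappedShellCensusCleanLimitsHaveWindowsCleanChartTComm1
import Summits.AtomisticToContinuum.Crystallization.Theorems.GappedShellCensusCleanLimitsHaveWindowsCleanChartTComm2
import Summits.AtomisticToContinuum.Crystallization.Theorems.GappedShellCensusCleanLimitsHaveWindowsCleanChartTComm3
import Summits.AtomisticToContinuum.Crystallization.Theorems.GappedShellCensusCleanLimitsHaveWindowsCleanChartTVComm1
import Summits.AtomisticToContinuum.Crystallization.Theorems.GappedShellCensusCleanLimitsHaveWindowsCleanChartTVComm2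
import Summits.AtomisticToContinuum.Crystallization.Theorems.PalmUnimodularRigidityShellsToBarlowChartTransportVComm3

/-!
# `CleanLimitsHaveWindows` (stmt-AtomisticToContinuum-15932), line `Sketch` — stub K1 (`stub_cleanChart`):
# the transport development re-run on CLEAN charts — copy of `PalmUnimodularRigidityShellsToBarlowChartTransportVComm3`

This file is a mechanical copy of `Theorems/PalmUnimodularRigidityShellsToBarlowChartTransportVComm3.lean` (crux `ShellsToBarlowChart`,
route `PalmUnimodularRigidity`; original title: Line `develop-the-model-growth-descent` (crux `ShellsToBarlowChart`, stmt-AtomisticToContinuum-9227): commutation of `V⁻¹` with `I` and `J` (part 3/3))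
in which the chart hypothesis `hch : ∀ z ∈ S, IsZChart S z (ac z) (Pc z) (Ac z) (nb z)` (integer charts with
`1 %` closeness) is replaced by the CLEAN-CHART hypothesis: at every site a labelling of the bonded neighbours
by `fcc3Int`/`hcpInt`, bijective, with bonds among neighbours = label pairs at squared distance `18`, together
with the TRANSFER property across every bond (proved for clean sets at matching radius `1/5` in
`…CleanChartTransfer`).  The original development uses its metric hypothesis only through the transfer
lemma, so all proofs go through verbatim; declarations live in the sub-namespace `….Clean` and shadow the
originals, the `hch`-free lemmas of the original file are reused, not restated.  All `[folklore]`.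
-/

noncomputable section

namespace Summit.AtomisticToContinuum.Crystallization.Theorems.PalmUnimodularRigidityShellsToBarlowChart.Clean

open Literature.Geometry.DiscreteGeometry Literature.MathematicalPhysics.StatisticalMechanics
open Summit.AtomisticToContinuum.Crystallization.Theorems.ShellsToBarlowChartNegative

variable {S : Set (EuclideanSpace ℝ (Fin 3))} {Pc : (EuclideanSpace ℝ (Fin 3)) → Finset (Fin 3 → ℤ)}
  {nb : (EuclideanSpace ℝ (Fin 3)) → (Fin 3 → ℤ) → (EuclideanSpace ℝ (Fin 3))}

/-- **`V⁻¹ ∘ I = I ∘ V⁻¹` (layer `k → k−1` coherence).**  For a valid frame `g` whose layer-`k`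
neighbourhood is valid and which commutes with the in-layer steps, the frame transported first
along `t₁` and then down equals the frame transported first down and then along its own `t₁`.
[folklore] -/
theorem VinvStep_Istep_comm (hch : ((∀ z ∈ S, (Pc z = fcc3Int ∨ Pc z = hcpInt) ∧ Set.BijOn (nb z) (↑(Pc z) : Set (Fin 3 → ℤ)) {y | y ∈ S ∧ (0 < dist z y ∧ dist z y ≤ 28 / 25)} ∧ (∀ t ∈ Pc z, ∀ t' ∈ Pc z, ((0 < dist (nb z t) (nb z t') ∧ dist (nb z t) (nb z t') ≤ 28 / 25) ↔ sqNormInt (t - t') = 18))) ∧ (∀ x ∈ S, ∀ y ∈ S, (0 < dist x y ∧ dist x y ≤ 28 / 25) → ∀ t ∈ Pc x, ∀ t' ∈ Pc x, ∀ u ∈ Pc y, ∀ u' ∈ Pc y, nb y u = nb x t → nb y u' = nb x t' → sqNormInt (u - u') = sqNormInt (t - t')))) {x : (EuclideanSpace ℝ (Fin 3))} (hx : x ∈ S) {t₁ t₂ : Fin 3 → ℤ} {U : Finset (Fin 3 → ℤ)} (hU : IsFrame (Pc x) t₁ t₂ U) (hI : IsFrame (Pc (nb x t₁)) (Istep Pc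 nb ⟨x, t₁, t₂, U⟩).t₁ (Istep Pc nb ⟨x, t₁, t₂, U⟩).t₂ (Istep Pc nb ⟨x, t₁, t₂, U⟩).U) (hJ : IsFrame (Pc (nb x t₂)) (Jstep Pc nb ⟨x, t₁, t₂, U⟩).t₁ (Jstep Pc nb ⟨x, t₁, t₂, U⟩).t₂ (Jstep Pc nb ⟨x, t₁, t₂, U⟩).U) (hIi : IsFrame (Pc (nb x (-t₁))) (IinvStep Pc nb ⟨x, t₁, t₂, U⟩).t₁ (IinvStep Pc nb ⟨x, t₁, t₂, U⟩).t₂ (IinvStep Pc nb ⟨x, t₁, t₂, U⟩).U) (hJi : IsFrame (Pc (nb x (-t₂))) (JinvStep Pc nb ⟨x, t₁, t₂, U⟩).t₁ (JinvStep Pc nb ⟨x, t₁, t₂, U⟩).t₂ (JinvStep Pc nb ⟨x, t₁, t₂, U⟩).U) (hII : IsFrame (Pc (nb (nb x t₁) (Istep Pc nb ⟨x, t₁, t₂, U⟩).t₁)) (Istep Pc nb (Istep Pc nb ⟨x, t₁, t₂, U⟩)).t₁ (Istep Pc nb (Istep Pc nb ⟨x, t₁, t₂, U⟩)).t₂ (Istep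 Pc nb (Istep Pc nb ⟨x, t₁, t₂, U⟩)).U) (hJI : IsFrame (Pc (nb (nb x t₁) (Istep Pc nb ⟨x, t₁, t₂, U⟩).t₂)) (Jstep Pc nb (Istep Pc nb ⟨x, t₁, t₂, U⟩)).t₁ (Jstep Pc nb (Istep Pc nb ⟨x, t₁, t₂, U⟩)).t₂ (Jstep Pc nb (Istep Pc nb ⟨x, t₁, t₂, U⟩)).U) (hIiI : IsFrame (Pc (nb (nb x t₁) (-(Istep Pc nb ⟨x, t₁, t₂, U⟩).t₁))) (IinvStep Pc nb (Istep Pc nb ⟨x, t₁, t₂, U⟩)).t₁ (IinvStep Pc nb (Istep Pc nb ⟨x, t₁, t₂, U⟩)).t₂ (IinvStep Pc nb (Istep Pc nb ⟨x, t₁, t₂, U⟩)).U) (hJiI : IsFrame (Pc (nb (nb x t₁) (-(Istep Pc nb ⟨x, t₁, t₂, U⟩).t₂))) (JinvStep Pc nb (Istep Pc nb ⟨x, t₁, t₂, U⟩)).t₁ (JinvStep Pc nb (Istep Pc nb ⟨x, t₁, t₂, U⟩)).t₂ (JinvStep Pc nb (Istep Pc nb ⟨x, t₁, t₂, U⟩)).U)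 (hcomm : Istep Pc nb (Jstep Pc nb ⟨x, t₁, t₂, U⟩) = Jstep Pc nb (Istep Pc nb ⟨x, t₁, t₂, U⟩)) : VinvStep Pc nb (Istep Pc nb ⟨x, t₁, t₂, U⟩) = Istep Pc nb (VinvStep Pc nb ⟨x, t₁, t₂, U⟩) := by
  have hregI := hregI_of_valid (Pc := Pc) (nb := nb) hI
  obtain ⟨hyS, hbxy, hwP, hwx, -, -, -, -, -, -, -, hframe, hparI, -⟩ := Istep_spec hch hx hU hregI
  obtain ⟨hd'L, hdS, hbd, hξP, hξx, hframeVi, -, hbr⟩ := VinvStep_spec hch hx hU hI hJ hIi hJi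
  obtain ⟨hpt, hbdd₁, -⟩ := VinvStep_Istep_pt hch hx hU hI hJ hIi hJi
  obtain ⟨hα, -⟩ := VinvStep_Istep_back hch hx hU hI hJ hIi hJi hII hJI hIiI hJiI
  obtain ⟨hβ, -⟩ := VinvStep_Istep_side hch hx hU hI hJ hIi hJi hII hJI hIiI hJiI hcomm
  obtain ⟨hptJ, -, -⟩ := VinvStep_Jstep_pt hch hx hU hI hJ hIi hJi
  have hPx := pattern_cases hch hx
  have hPy := pattern_cases hch hyS
  have hPd := pattern_cases hch hdS
  obtain ⟨h12, hhex, hUP, -, -⟩ := id hU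
  have ht₁ : t₁ ∈ Pc x := hhex (mem_hexLabels_iff.2 (Or.inl rfl))
  have ht₂ : t₂ ∈ Pc x := hhex (mem_hexLabels_iff.2 (Or.inr (Or.inl rfl)))
  -- canonical names at `x`: `d', d, τ₁, τ₂, Ud`
  set d' := apexOf t₁ t₂ (lowerCap (Pc x) t₁ t₂ U) with hd'_def
  have hd'P : d' ∈ Pc x := (mem_lowerCap_iff.1 hd'L).1
  have hVpt : (VinvStep Pc nb ⟨x, t₁, t₂, U⟩).pt = nb x d' := rfl
  rw [hVpt] at *
  set d := nb x d' with hd_def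
  set τ₁ := (VinvStep Pc nb ⟨x, t₁, t₂, U⟩).t₁ with hτ₁_def
  set τ₂ := (VinvStep Pc nb ⟨x, t₁, t₂, U⟩).t₂ with hτ₂_def
  set Ud := (VinvStep Pc nb ⟨x, t₁, t₂, U⟩).U with hUd_def
  have hVeq : VinvStep Pc nb ⟨x, t₁, t₂, U⟩ = ⟨d, τ₁, τ₂, Ud⟩ := rfl
  obtain ⟨h12d, hhexd, hUdP, hoffd, -⟩ := id hframeVi
  have hτ₁P : τ₁ ∈ Pc d := hhexd (mem_hexLabels_iff.2 (Or.inl rfl))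
  have hτ₂P : τ₂ ∈ Pc d := hhexd (mem_hexLabels_iff.2 (Or.inr (Or.inl rfl)))
  -- the frame `I g = ⟨y, a', b', U'⟩`
  set a' := (Istep Pc nb ⟨x, t₁, t₂, U⟩).t₁ with ha'
  set b' := (Istep Pc nb ⟨x, t₁, t₂, U⟩).t₂ with hb'
  set U' := (Istep Pc nb ⟨x, t₁, t₂, U⟩).U with hU'
  have hIeq : Istep Pc nb ⟨x, t₁, t₂, U⟩ = ⟨nb x t₁, a', b', U'⟩ := rfl
  rw [hIeq] at hII hJI hIiI hJiI hpt hbdd₁ hα hβ ⊢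
  obtain ⟨hdL'L, hd₁S, hbyd₁, hξ'P, hξ'y, hframeVi', -, hbr'⟩ :=
    VinvStep_spec hch hyS hframe hII hJI hIiI hJiI
  set dL' := apexOf a' b' (lowerCap (Pc (nb x t₁)) a' b' U') with hdL'_def
  have hdL'P : dL' ∈ Pc (nb x t₁) := (mem_lowerCap_iff.1 hdL'L).1
  have hV'pt : (VinvStep Pc nb ⟨nb x t₁, a', b', U'⟩).pt = nb (nb x t₁) dL' := rfl
  rw [hV'pt] at *
  set d₁ := nb (nb x t₁) dL' with hd₁_def
  set τ₁'' := (VinvStep Pc nb ⟨nb x t₁, a', b', U'⟩).t₁ with hτ₁''_def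
  set τ₂'' := (VinvStep Pc nb ⟨nb x t₁, a', b', U'⟩).t₂ with hτ₂''_def
  set U₁ := (VinvStep Pc nb ⟨nb x t₁, a', b', U'⟩).U with hU₁_def
  have hV'eq : VinvStep Pc nb ⟨nb x t₁, a', b', U'⟩ = ⟨d₁, τ₁'', τ₂'', U₁⟩ := rfl
  have hPd₁ := pattern_cases hch hd₁S
  obtain ⟨h12'', hhex'', -, -, -⟩ := id hframeVi'
  have hτ₁''P : τ₁'' ∈ Pc d₁ := hhex'' (mem_hexLabels_iff.2 (Or.inl rfl))
  have hτ12''P : τ₁'' - τ₂'' ∈ Pc d₁ :=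
    hhex'' (mem_hexLabels_iff.2 (Or.inr (Or.inr (Or.inr (Or.inr (Or.inr rfl))))))
  -- the three identifications
  have hd₁' : nb d τ₁ = d₁ := hpt.symm
  have hw' : zlab Pc nb d₁ d = -τ₁'' := hα
  rw [hVeq] at hptJ
  have hdJ : nb d τ₂ = (VinvStep Pc nb (Jstep Pc nb ⟨x, t₁, t₂, U⟩)).pt := hptJ.symm
  have hv' : zlab Pc nb d₁ (nb d τ₂) = τ₂'' - τ₁'' := by rw [hdJ]; exact hβ
  -- the I-step of `V⁻¹ g` (layer `k−1`)
  have hreg3 : Pc (nb d τ₁) = fcc3Int ∨ Pc d = hcpInt ∨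
      (-zlab Pc nb (nb d τ₁) d ∈ Pc (nb d τ₁) ∧ -zlab Pc nb (nb d τ₁) (nb d τ₂) ∈ Pc (nb d τ₁)) := by
    refine Or.inr (Or.inr ⟨?_, ?_⟩)
    · rw [hd₁', hw', neg_neg]; exact hτ₁''P
    · rw [hd₁', hv', neg_sub]; exact hτ12''P
  obtain ⟨-, -, -, -, -, -, -, -, -, -, -, -, -, c₁, hc₁U, -, hfilt₁, hbur, hrU, hUeq₂, -⟩ :=
    Istep_spec hch hdS hframeVi hreg3
  have ept : (Istep Pc nb ⟨d, τ₁, τ₂, Ud⟩).pt = d₁ := hd₁'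
  have e₁ : (Istep Pc nb ⟨d, τ₁, τ₂, Ud⟩).t₁ = τ₁'' := by
    show -zlab Pc nb (nb d τ₁) d = τ₁''
    rw [hd₁', hw', neg_neg]
  have e₂ : (Istep Pc nb ⟨d, τ₁, τ₂, Ud⟩).t₂ = τ₂'' := by
    show zlab Pc nb (nb d τ₁) (nb d τ₂) - zlab Pc nb (nb d τ₁) d = τ₂''
    rw [hd₁', hv', hw']; abel
  rw [hd₁'] at hbur hrU hUeq₂
  rw [e₁, e₂] at hUeq₂
  -- the transported reference `r = zlab d₁ (nb d c₁)` is the label of `x` (letter `+1`) or of `Ix`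
  -- (letter `−1`) at `d₁`, hence lies in `U₁`
  have hrU₁ : zlab Pc nb d₁ (nb d c₁) ∈ U₁ := by
    have hξoff : zlab Pc nb d x ∉ hexLabels τ₁ τ₂ := by
      rcases hbr with ⟨-, hUd, -, -, -⟩ | ⟨-, hUd, -, -, -⟩
      · exact hoffd _ (by rw [hUd]; simp)
      · exact hoffd _ (by rw [hUd]; simp)
    rcases hbr with ⟨hlp, hUd, hnI, -, -⟩ | ⟨hlp, hUd, hnI, -, -⟩
    · -- `Ud = {ξ, ξ − τ₁, ξ − τ₂}`: the element touching `τ₁` is `ξ`, so `nb d c₁ = x`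
      have hx1 : zlab Pc nb d x - τ₁ ∈ Pc d := hUdP (by rw [hUd]; simp)
      have hx2 : zlab Pc nb d x - τ₂ ∈ Pc d := hUdP (by rw [hUd]; simp)
      have hc₁ : c₁ = zlab Pc nb d x := by
        have h1 := (filter_evenCap (Pc d) hPd τ₁ hτ₁P τ₂ hτ₂P _ hξP h12d hhexd hξoff hx1 hx2).1
        rw [← hUd, hfilt₁] at h1
        exact Finset.singleton_injective h1
      rw [hc₁, hξx]
      -- `x` has label `ξ' − τ₁''` at `d₁`
      rcases hbr' with ⟨-, hUd₁, hnI', -, -⟩ | ⟨hlp'', -, -, -, -⟩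
      swap
      · obtain ⟨hlp', -, -⟩ := attach_lower_I_pos hch hx hU hlp hregI
        rw [hIeq] at hlp'
        exact absurd (hlp'.symm.trans hlp'') (by norm_num)
      have hyx : nb (nb x t₁) (-a') = x := by
        show nb (nb x t₁) (-(-zlab Pc nb (nb x t₁) x)) = x
        rw [neg_neg]; exact hwx
      rw [hyx] at hnI'
      have hmem : zlab Pc nb d₁ (nb x t₁) - τ₁'' ∈ U₁ := by rw [hUd₁]; simp
      have hlab : zlab Pc nb d₁ x = zlab Pc nb d₁ (nb x t₁) - τ₁'' := by
        have h := zlab_nb hch hd₁S (hframeVi'.2.2.1 hmem)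
        rwa [hnI'] at h
      rw [hlab]; exact hmem
    · -- `Ud = {ξ, ξ + τ₁, ξ + τ₂}`: the element touching `τ₁` is `ξ + τ₁`, so `nb d c₁ = Ix`
      have hx1 : zlab Pc nb d x + τ₁ ∈ Pc d := hUdP (by rw [hUd]; simp)
      have hx2 : zlab Pc nb d x + τ₂ ∈ Pc d := hUdP (by rw [hUd]; simp)
      have hc₁ : c₁ = zlab Pc nb d x + τ₁ := by
        have h1 := (filter_oddCap (Pc d) hPd τ₁ hτ₁P τ₂ hτ₂P _ hξP h12d hhexd hξoff hx1 hx2).1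
        rw [← hUd, hfilt₁] at h1
        exact Finset.singleton_injective h1
      rw [hc₁, hnI]
      rcases hbr' with ⟨hlp'', -, -, -, -⟩ | ⟨-, hUd₁, -, -, -⟩
      · obtain ⟨hlp', -, -⟩ := attach_lower_I_neg hch hx hU hlp hregI
        rw [hIeq] at hlp'
        exact absurd (hlp'.symm.trans hlp'') (by norm_num)
      rw [hUd₁]; simp
  have hU₂ : (Istep Pc nb ⟨d, τ₁, τ₂, Ud⟩).U = U₁ := by
    rw [hUeq₂]; exact capWithAny_of_mem_cap hch hd₁S hframeVi' hrU₁
  rw [hVeq, hV'eq]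
  exact (ZFrame.ext' ept e₁ e₂ hU₂).symm

/-- **`V⁻¹ ∘ J = J ∘ V⁻¹`**, from `VinvStep_Istep_comm` by the swap symmetry. [folklore] -/
theorem VinvStep_Jstep_comm (hch : ((∀ z ∈ S, (Pc z = fcc3Int ∨ Pc z = hcpInt) ∧ Set.BijOn (nb z) (↑(Pc z) : Set (Fin 3 → ℤ)) {y | y ∈ S ∧ (0 < dist z y ∧ dist z y ≤ 28 / 25)} ∧ (∀ t ∈ Pc z, ∀ t' ∈ Pc z, ((0 < dist (nb z t) (nb z t') ∧ dist (nb z t) (nb z t') ≤ 28 / 25) ↔ sqNormInt (t - t') = 18))) ∧ (∀ x ∈ S, ∀ y ∈ S, (0 < dist x y ∧ dist x y ≤ 28 / 25) → ∀ t ∈ Pc x, ∀ t' ∈ Pc x, ∀ u ∈ Pc y, ∀ u' ∈ Pc y, nb y u = nb x t → nb y u' = nb x t' → sqNormInt (u - u') = sqNormInt (t - t')))) {x : (EuclideanSpace ℝ (Fin 3))}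
    (hx : x ∈ S) {t₁ t₂ : Fin 3 → ℤ} {U : Finset (Fin 3 → ℤ)} (hU : IsFrame (Pc x) t₁ t₂ U)
    (hI : IsFrame (Pc (nb x t₁)) (Istep Pc nb ⟨x, t₁, t₂, U⟩).t₁ (Istep Pc nb ⟨x, t₁, t₂, U⟩).t₂
      (Istep Pc nb ⟨x, t₁, t₂, U⟩).U)
    (hJ : IsFrame (Pc (nb x t₂)) (Jstep Pc nb ⟨x, t₁, t₂, U⟩).t₁ (Jstep Pc nb ⟨x, t₁, t₂, U⟩).t₂
      (Jstep Pc nb ⟨x, t₁, t₂, U⟩).U)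
    (hIi : IsFrame (Pc (nb x (-t₁))) (IinvStep Pc nb ⟨x, t₁, t₂, U⟩).t₁
      (IinvStep Pc nb ⟨x, t₁, t₂, U⟩).t₂ (IinvStep Pc nb ⟨x, t₁, t₂, U⟩).U)
    (hJi : IsFrame (Pc (nb x (-t₂))) (JinvStep Pc nb ⟨x, t₁, t₂, U⟩).t₁
      (JinvStep Pc nb ⟨x, t₁, t₂, U⟩).t₂ (JinvStep Pc nb ⟨x, t₁, t₂, U⟩).U)
    (hJJ : IsFrame (Pc (nb (nb x t₂) (Jstep Pc nb ⟨x, t₁, t₂, U⟩).t₂))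
      (Jstep Pc nb (Jstep Pc nb ⟨x, t₁, t₂, U⟩)).t₁ (Jstep Pc nb (Jstep Pc nb ⟨x, t₁, t₂, U⟩)).t₂
      (Jstep Pc nb (Jstep Pc nb ⟨x, t₁, t₂, U⟩)).U)
    (hIJ : IsFrame (Pc (nb (nb x t₂) (Jstep Pc nb ⟨x, t₁, t₂, U⟩).t₁))
      (Istep Pc nb (Jstep Pc nb ⟨x, t₁, t₂, U⟩)).t₁ (Istep Pc nb (Jstep Pc nb ⟨x, t₁, t₂, U⟩)).t₂
      (Istep Pc nb (Jstep Pc nb ⟨x, t₁, t₂, U⟩)).U)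
    (hJiJ : IsFrame (Pc (nb (nb x t₂) (-(Jstep Pc nb ⟨x, t₁, t₂, U⟩).t₂)))
      (JinvStep Pc nb (Jstep Pc nb ⟨x, t₁, t₂, U⟩)).t₁ (JinvStep Pc nb (Jstep Pc nb ⟨x, t₁, t₂, U⟩)).t₂
      (JinvStep Pc nb (Jstep Pc nb ⟨x, t₁, t₂, U⟩)).U)
    (hIiJ : IsFrame (Pc (nb (nb x t₂) (-(Jstep Pc nb ⟨x, t₁, t₂, U⟩).t₁)))
      (IinvStep Pc nb (Jstep Pc nb ⟨x, t₁, t₂, U⟩)).t₁ (IinvStep Pc nb (Jstep Pc nb ⟨x, t₁, t₂, U⟩)).t₂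
      (IinvStep Pc nb (Jstep Pc nb ⟨x, t₁, t₂, U⟩)).U)
    (hcomm : Istep Pc nb (Jstep Pc nb ⟨x, t₁, t₂, U⟩) = Jstep Pc nb (Istep Pc nb ⟨x, t₁, t₂, U⟩)) :
    VinvStep Pc nb (Jstep Pc nb ⟨x, t₁, t₂, U⟩) = Jstep Pc nb (VinvStep Pc nb ⟨x, t₁, t₂, U⟩) := by
  have hPx := pattern_cases hch hx
  have hU' : IsFrame (Pc x) t₂ t₁ U := isFrame_swap hU
  obtain ⟨hI', hJ', hIi', hJi'⟩ := swap_hyps (Pc := Pc) (nb := nb) hI hJ hIi hJi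
  have hII' : IsFrame (Pc (nb (nb x t₂) (Istep Pc nb ⟨x, t₂, t₁, U⟩).t₁))
      (Istep Pc nb (Istep Pc nb ⟨x, t₂, t₁, U⟩)).t₁ (Istep Pc nb (Istep Pc nb ⟨x, t₂, t₁, U⟩)).t₂
      (Istep Pc nb (Istep Pc nb ⟨x, t₂, t₁, U⟩)).U := by
    rw [Istep_swap x t₁ t₂ U, Istep_swap' (Jstep Pc nb ⟨x, t₁, t₂, U⟩)]
    exact isFrame_swap hJJ
  have hJI' : IsFrame (Pc (nb (nb x t₂) (Istep Pc nb ⟨x, t₂, t₁, U⟩).t₂))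
      (Jstep Pc nb (Istep Pc nb ⟨x, t₂, t₁, U⟩)).t₁ (Jstep Pc nb (Istep Pc nb ⟨x, t₂, t₁, U⟩)).t₂
      (Jstep Pc nb (Istep Pc nb ⟨x, t₂, t₁, U⟩)).U := by
    rw [Istep_swap x t₁ t₂ U, Jstep_swap' (Jstep Pc nb ⟨x, t₁, t₂, U⟩)]
    exact isFrame_swap hIJ
  have hIiI' : IsFrame (Pc (nb (nb x t₂) (-(Istep Pc nb ⟨x, t₂, t₁, U⟩).t₁)))
      (IinvStep Pc nb (Istep Pc nb ⟨x, t₂, t₁, U⟩)).t₁ (IinvStep Pc nb (Istep Pc nb ⟨x, t₂, t₁, U⟩)).t₂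
      (IinvStep Pc nb (Istep Pc nb ⟨x, t₂, t₁, U⟩)).U := by
    rw [Istep_swap x t₁ t₂ U, IinvStep_swap' (Jstep Pc nb ⟨x, t₁, t₂, U⟩)]
    exact isFrame_swap hJiJ
  have hJiI' : IsFrame (Pc (nb (nb x t₂) (-(Istep Pc nb ⟨x, t₂, t₁, U⟩).t₂)))
      (JinvStep Pc nb (Istep Pc nb ⟨x, t₂, t₁, U⟩)).t₁ (JinvStep Pc nb (Istep Pc nb ⟨x, t₂, t₁, U⟩)).t₂
      (JinvStep Pc nb (Istep Pc nb ⟨x, t₂, t₁, U⟩)).U := by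
    rw [Istep_swap x t₁ t₂ U, JinvStep_swap' (Jstep Pc nb ⟨x, t₁, t₂, U⟩)]
    exact isFrame_swap hIiJ
  have hcomm' : Istep Pc nb (Jstep Pc nb ⟨x, t₂, t₁, U⟩) = Jstep Pc nb (Istep Pc nb ⟨x, t₂, t₁, U⟩) := by
    rw [Jstep_swap x t₂ t₁ U, Istep_swap x t₁ t₂ U, Istep_swap' (Istep Pc nb ⟨x, t₁, t₂, U⟩),
      Jstep_swap' (Jstep Pc nb ⟨x, t₁, t₂, U⟩), hcomm]
  have key := VinvStep_Istep_comm hch hx hU' hI' hJ' hIi' hJi' hII' hJI' hIiI' hJiI' hcomm'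
  have hregJ := hregJ_of_valid (Pc := Pc) (nb := nb) hJ
  obtain ⟨hyJS, -, -, -, -, -, -, -, -, -, -, hJframe, -⟩ := Jstep_spec hch hx hU hregJ
  have hPyJ := pattern_cases hch hyJS
  obtain ⟨-, hdS, -, -, -, hframeVi, -⟩ := VinvStep_spec hch hx hU hI hJ hIi hJi
  have hPd := pattern_cases hch hdS
  rw [Istep_swap x t₁ t₂ U, VinvStep_swap hPx hU] at key
  rw [VinvStep_swap' (f := Jstep Pc nb ⟨x, t₁, t₂, U⟩) hPyJ hJframe] at key
  rw [Istep_swap' (Pc := Pc) (nb := nb) (VinvStep Pc nb ⟨x, t₁, t₂, U⟩)] at key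
  obtain ⟨h1, h2, h3, h4⟩ := ZFrame.mk.inj key
  exact ZFrame.ext' h1 h3 h2 h4

end Summit.AtomisticToContinuum.Crystallization.Theorems.PalmUnimodularRigidityShellsToBarlowChart.Clean

end
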